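import Literature.InformationTheory.Entanglement.GHZFidelityWitness
import Mathlib.Analysis.SpecialFunctions.Complex.Arg
import Mathlib.Analysis.SpecialFunctions.Integrals.Basic
import HarnessLib

/-!
# GHZ parity oscillations: the rotated parity signal and the coherence `C = |ρ_{0…0,1…1}| + |ρ_{1…1,0…0}|`

Topic `Literature/InformationTheory/Entanglement`, companion of `GHZFidelityWitness.lean` (same
register `Fin N → Bool`, same `populations` / `coherence`, `trState`).  Source (held text, read at
the cited place):

* T. Monz, P. Schindler, J. T. Barreiro, M. Chwalla, D. Nigg, W. A. Coish, M. Harlander,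
  W. Hänsel, M. Hennrich, R. Blatt, *14-qubit entanglement: creation and coherence*, PRL 106,
  130506 (2011) = arXiv:1009.6126 [MonzEtAl2011], p. 3: “The diagonal elements of the density
  matrix `ρ` are directly measured by fluorescence detection and allow to infer the GHZ populations
  `P = ρ_{0…0,0…0} + ρ_{1…1,1…1}`.  The off-diagonal elements of the density matrix are accessible
  via the observation of parity oscillations as follows.  After the GHZ-state is generated, all
  qubits are collectively rotated by an operation `⊗_{j=1}^N exp(i π/4 σ_φ^{(j)})` where
  `σ_φ^{(j)} = σ_x^{(j)} cos φ + σ_y^{(j)} sin φ` … By varying the phase `φ`, we observe oscillations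
  of the parity `𝒫 = 𝒫_even − 𝒫_odd` with `𝒫_{even/odd}` corresponding to the probability of finding
  the state with an even/odd number of excitations.  **The amplitude of these oscillations directly
  gives the coherence `C = |ρ_{0…0,1…1}| + |ρ_{1…1,0…0}|` of the state.**  The fidelity of the GHZ
  state is then given by `F = (P + C)/2`”.

HONEST FRAMING (pub-qadeq lane — every GHZ-state milestone whose fidelity is quoted as
`F = (P + C)/2` with `C` read off a parity fringe: trapped ions, superconducting qubits, Rydberg
arrays): instance-level adjudication of specific advantage claims; no claim about BQP vs BPP or
the summit.  This file derives the parity signal of the printed protocol exactly, for an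
ARBITRARY `N`-qubit density matrix; fitting, shot noise and pulse errors are not addressed.

## Contents (all proved, 0 named facts)

* `tensorWord M` (the operator `⊗_j M_j` on the register; `tensorWord_mul`,
  `tensorWord_conjTranspose`), `sigmaPhi φ = σ_x cos φ + σ_y sin φ`, `pulse φ = exp(i π/4 σ_φ)
  = (𝟙 + iσ_φ)/√2` (`sigmaPhi_mul_self`, `pulse_conjTranspose_mul_pulse` — unitarity),
  `pulseAll N φ = ⊗_j pulse φ`, `parityOp N = ⊗_j σ_z` with **`trState_parityOp`**
  (`Tr(σ Π) = 𝒫_even(σ) − 𝒫_odd(σ)`), and the signal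
  `paritySignal ρ φ = Tr(U ρ U† Π) = Tr(ρ U†ΠU)` (`paritySignal_eq_rotated_state`).
* **`rotZ_apply`**: `u_φ† σ_z u_φ` is off-diagonal with entries `i e^{−iφ}` (`|0⟩⟨1|`) and
  `−i e^{iφ}` (`|1⟩⟨0|`); **`rotated_parityOp`**: `U†ΠU = ⊗_j (u_φ† σ_z u_φ)`.
* **`paritySignal_eq_sum`** — the signal of ANY `ρ`:
  `𝒫(φ) = Re Σ_x ρ_{x,x̄} (i e^{−iφ})^{|x|} (−i e^{iφ})^{N−|x|}`: only ANTI-diagonal entries `ρ_{x,x̄}`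
  contribute, the entry `ρ_{x,x̄}` at the harmonic `e^{i(N−2|x|)φ}`.
* **`paritySignal_eq_of_antidiag_zero`** — if the inner anti-diagonal entries vanish
  (`ρ_{x,x̄} = 0` for `x ∉ {0…0, 1…1}`, as for GHZ states with population/dephasing noise) and
  `ρ_{1…1,0…0} = conj ρ_{0…0,1…1}`, then `𝒫(φ) = 2 Re(ρ_{0…0,1…1} (−i e^{iφ})^N)`: a pure fringe
  of order `N` whose amplitude is exactly `C`: **`abs_paritySignal_le_coherence`** and
  **`exists_paritySignal_eq_coherence`** (“the amplitude of these oscillations directly gives the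
  coherence `C`”).
* `harmonic_factor` (`(i e^{−iφ})^k (−i e^{iφ})^m = i^k (−i)^m e^{i(m−k)φ}`) and
  `inner_excitations_bounds` (for inner `x`, `1 ≤ |x| ≤ N − 1`, so its harmonic order `|N − 2|x||`
  is at most `N − 2`): for a general `ρ` only `ρ_{0…0,1…1}`, `ρ_{1…1,0…0}` reach the order-`N`
  fringe from which `C` is read, the other anti-diagonal coherences feed lower harmonics.
* `tensorWord_one`, `pulseAll_conjTranspose_mul` (`U_φ† U_φ = 𝟙`).

* **`integral_paritySignal_mul_exp`** — for an ARBITRARY `ρ` (`N ≥ 1`):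
  `∫_0^{2π} 𝒫(φ) e^{−iNφ} dφ = π (−i)^N (ρ_{0…0,1…1} + conj ρ_{1…1,0…0})`: the order-`N` Fourier
  component of the fringe is exactly the GHZ coherence (modulus `π·C` for Hermitian `ρ`).

NOT formalised: fitting statistics, pulse imperfections.

## Mathlib / tree search

No parity-oscillation material in Mathlib or the tree (`lean search 'parity.*oscillation|sigmaPhi'`
empty).  `MerminKlyshkoGHZ.pauliWord P` is the special case `tensorWord (fun j => (P j).mat)` of
the tensor word defined here (stated for general one-qubit factors because the pulse is not a
Pauli matrix).  Reused: `Pauli.mat` (`PauliExpansion.lean`), `trState` (`TsirelsonBound.lean`),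
`constLabel`, `coherence` (`GHZFidelityWitness.lean`).
-/

namespace Literature.InformationTheory.Entanglement

namespace ParityOscillation

open Matrix Complex Finset
open Literature.Computability.QuantumComplexity
open Literature.InformationTheory.Entanglement.Tsirelson
open GHZWitness

variable {N : ℕ}

/-! ## Tensor words of one-qubit operators -/

/-- The operator `⊗_{j=1}^N M_j` on the register, `⟨y|⊗_j M_j|x⟩ = Π_j ⟨y_j|M_j|x_j⟩` (the
“`⊗_{j=1}^N exp(i π/4 σ_φ^{(j)})`” of the protocol). [cite: MonzEtAl2011, p. 3] -/
def tensorWord (M : Fin N → Matrix Bool Bool ℂ) : Matrix (Fin N → Bool) (Fin N → Bool) ℂ :=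
  Matrix.of fun y x => ∏ j, M j (y j) (x j)

/-- Entries of a tensor word. [cite: MonzEtAl2011, p. 3] -/
theorem tensorWord_apply (M : Fin N → Matrix Bool Bool ℂ) (y x : Fin N → Bool) :
    tensorWord M y x = ∏ j, M j (y j) (x j) := rfl

/-- `(⊗_j A_j)(⊗_j B_j) = ⊗_j (A_j B_j)`. [cite: MonzEtAl2011, p. 3] -/
theorem tensorWord_mul (A B : Fin N → Matrix Bool Bool ℂ) :
    tensorWord (fun j => A j * B j) = tensorWord A * tensorWord B := by
  ext y x
  rw [tensorWord_apply, Matrix.mul_apply]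
  simp only [Matrix.mul_apply, tensorWord_apply]
  rw [Fintype.prod_sum]
  refine Finset.sum_congr rfl fun z _ => ?_
  rw [← Finset.prod_mul_distrib]

/-- `(⊗_j M_j)† = ⊗_j M_j†`. [cite: MonzEtAl2011, p. 3] -/
theorem tensorWord_conjTranspose (M : Fin N → Matrix Bool Bool ℂ) :
    (tensorWord M)ᴴ = tensorWord fun j => (M j)ᴴ := by
  ext y x
  simp only [conjTranspose_apply, tensorWord_apply, star_prod]

/-! ## The analysis pulse `exp(i π/4 σ_φ)` and the rotated `σ_z` -/

/-- `σ_φ = σ_x cos φ + σ_y sin φ`. [cite: MonzEtAl2011, p. 3] -/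
noncomputable def sigmaPhi (φ : ℝ) : Matrix Bool Bool ℂ :=
  (Real.cos φ : ℂ) • Pauli.X.mat + (Real.sin φ : ℂ) • Pauli.Y.mat

/-- Entries of `σ_φ`: `⟨0|σ_φ|1⟩ = e^{−iφ}`, `⟨1|σ_φ|0⟩ = e^{iφ}`, zero diagonal.
[cite: MonzEtAl2011, p. 3] -/
theorem sigmaPhi_apply (φ : ℝ) (a b : Bool) :
    sigmaPhi φ a b = if a = b then 0 else if a then exp (φ * I) else exp (-(φ * I)) := by
  have hneg : -((φ : ℂ) * I) = ((-φ : ℝ) : ℂ) * I := by push_cast; ring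
  rw [hneg, Complex.exp_mul_I, Complex.exp_mul_I, ← Complex.ofReal_cos, ← Complex.ofReal_sin,
    ← Complex.ofReal_cos, ← Complex.ofReal_sin, Real.cos_neg, Real.sin_neg]
  cases a <;> cases b <;> simp [sigmaPhi, Matrix.add_apply, Matrix.smul_apply]

/-- `σ_φ² = 𝟙`, so `exp(iθσ_φ) = cos θ 𝟙 + i sin θ σ_φ`. [cite: MonzEtAl2011, p. 3] -/
theorem sigmaPhi_mul_self (φ : ℝ) : sigmaPhi φ * sigmaPhi φ = 1 := by
  have hexp : exp (-((φ : ℂ) * I)) * exp ((φ : ℂ) * I) = 1 := by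
    rw [← Complex.exp_add, neg_add_cancel, Complex.exp_zero]
  have hexp' : exp ((φ : ℂ) * I) * exp (-((φ : ℂ) * I)) = 1 := by rw [mul_comm, hexp]
  ext a b
  cases a <;> cases b <;> simp [Pauli.mul_apply_bool, sigmaPhi_apply, hexp, hexp']

/-- The analysis pulse `u_φ = exp(i π/4 σ_φ) = (𝟙 + i σ_φ)/√2` (using `σ_φ² = 𝟙`:
`exp(iθσ_φ) = cos θ·𝟙 + i sin θ·σ_φ` at `θ = π/4`). [cite: MonzEtAl2011, p. 3] -/
noncomputable def pulse (φ : ℝ) : Matrix Bool Bool ℂ :=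
  (CHSHOpt.invSqrtTwo : ℂ) • (1 + I • sigmaPhi φ)

/-- Entries of the pulse. [cite: MonzEtAl2011, p. 3] -/
theorem pulse_apply (φ : ℝ) (a b : Bool) :
    pulse φ a b = (CHSHOpt.invSqrtTwo : ℂ) *
      (if a = b then 1 else I * (if a then exp (φ * I) else exp (-(φ * I)))) := by
  cases a <;> cases b <;> simp [pulse, Matrix.add_apply, Matrix.smul_apply, sigmaPhi_apply]

/-- `2·(1/√2)² = 1` in `ℂ`. [cite: MonzEtAl2011, p. 3] -/
private theorem two_mul_invSqrtTwo_sq :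
    (2 : ℂ) * ((CHSHOpt.invSqrtTwo : ℂ) * (CHSHOpt.invSqrtTwo : ℂ)) = 1 := by
  rw [← Complex.ofReal_mul, CHSHOpt.invSqrtTwo_mul_self]; push_cast; ring

/-- `conj e^{iφ} = e^{−iφ}`. [cite: MonzEtAl2011, p. 3] -/
private theorem conj_expI (φ : ℝ) : (starRingEnd ℂ) (exp ((φ : ℂ) * I)) = exp (-((φ : ℂ) * I)) := by
  rw [← Complex.exp_conj, map_mul, Complex.conj_ofReal, Complex.conj_I]; ring_nf

/-- `conj e^{−iφ} = e^{iφ}`. [cite: MonzEtAl2011, p. 3] -/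
private theorem conj_expNegI (φ : ℝ) :
    (starRingEnd ℂ) (exp (-((φ : ℂ) * I))) = exp ((φ : ℂ) * I) := by
  rw [← Complex.exp_conj, map_neg, map_mul, Complex.conj_ofReal, Complex.conj_I]; ring_nf

/-- `e^{−iφ} e^{iφ} = 1`. [cite: MonzEtAl2011, p. 3] -/
private theorem expNegI_mul_expI (φ : ℝ) : exp (-((φ : ℂ) * I)) * exp ((φ : ℂ) * I) = 1 := by
  rw [← Complex.exp_add, neg_add_cancel, Complex.exp_zero]

/-- The pulse is unitary: `u_φ† u_φ = 𝟙`. [cite: MonzEtAl2011, p. 3] -/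
theorem pulse_conjTranspose_mul_pulse (φ : ℝ) : (pulse φ)ᴴ * pulse φ = 1 := by
  have h2 := two_mul_invSqrtTwo_sq
  have e1 := expNegI_mul_expI φ
  have c1 := conj_expI φ
  have c2 := conj_expNegI φ
  ext a b
  cases a <;> cases b
  · simp [Pauli.mul_apply_bool, conjTranspose_apply, pulse_apply, c1]
    linear_combination (-((CHSHOpt.invSqrtTwo : ℂ) ^ 2 * (exp (-((φ : ℂ) * I)) * exp ((φ : ℂ) * I)))) *
      Complex.I_sq + (CHSHOpt.invSqrtTwo : ℂ) ^ 2 * e1 + h2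
  · simp [Pauli.mul_apply_bool, conjTranspose_apply, pulse_apply, c1]
    ring
  · simp [Pauli.mul_apply_bool, conjTranspose_apply, pulse_apply, c2]
    ring
  · simp [Pauli.mul_apply_bool, conjTranspose_apply, pulse_apply, c2]
    linear_combination (-((CHSHOpt.invSqrtTwo : ℂ) ^ 2 * (exp (-((φ : ℂ) * I)) * exp ((φ : ℂ) * I)))) *
      Complex.I_sq + (CHSHOpt.invSqrtTwo : ℂ) ^ 2 * e1 + h2

/-- The rotated `σ_z`: `u_φ† σ_z u_φ`. [cite: MonzEtAl2011, p. 3] -/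
noncomputable def rotZ (φ : ℝ) : Matrix Bool Bool ℂ := (pulse φ)ᴴ * Pauli.Z.mat * pulse φ

/-- **The rotated `σ_z` is off-diagonal**: `u_φ† σ_z u_φ = i e^{−iφ}|0⟩⟨1| − i e^{iφ}|1⟩⟨0|`
(`= σ_x sin φ − σ_y cos φ`). [cite: MonzEtAl2011, p. 3] -/
theorem rotZ_apply (φ : ℝ) (a b : Bool) :
    rotZ φ a b = if a = b then 0 else if a then -I * exp (φ * I) else I * exp (-(φ * I)) := by
  have h2 := two_mul_invSqrtTwo_sq
  have e1 := expNegI_mul_expI φ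
  have c1 := conj_expI φ
  have c2 := conj_expNegI φ
  rw [rotZ, Matrix.mul_assoc]
  cases a <;> cases b
  · simp [Pauli.mul_apply_bool, conjTranspose_apply, pulse_apply, c1]
    linear_combination ((CHSHOpt.invSqrtTwo : ℂ) ^ 2 * (exp (-((φ : ℂ) * I)) * exp ((φ : ℂ) * I))) *
      Complex.I_sq - (CHSHOpt.invSqrtTwo : ℂ) ^ 2 * e1
  · simp [Pauli.mul_apply_bool, conjTranspose_apply, pulse_apply, c1]
    linear_combination (I * exp (-((φ : ℂ) * I))) * h2
  · simp [Pauli.mul_apply_bool, conjTranspose_apply, pulse_apply, c2]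
    linear_combination (-(I * exp ((φ : ℂ) * I))) * h2
  · simp [Pauli.mul_apply_bool, conjTranspose_apply, pulse_apply, c2]
    linear_combination (-((CHSHOpt.invSqrtTwo : ℂ) ^ 2 * (exp (-((φ : ℂ) * I)) * exp ((φ : ℂ) * I)))) *
      Complex.I_sq + (CHSHOpt.invSqrtTwo : ℂ) ^ 2 * e1

/-! ## Register level: `Π = ⊗σ_z`, the pulse on all qubits, the signal -/

/-- `⊗_j 𝟙 = 𝟙`. [cite: MonzEtAl2011, p. 3] -/
theorem tensorWord_one : tensorWord (fun _ : Fin N => (1 : Matrix Bool Bool ℂ)) = 1 := by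
  ext y x
  rw [tensorWord_apply, Matrix.one_apply]
  by_cases h : y = x
  · subst h
    simp
  · rw [if_neg h]
    have : ∃ j, y j ≠ x j := by
      by_contra hall
      push Not at hall
      exact h (funext hall)
    obtain ⟨j, hj⟩ := this
    exact Finset.prod_eq_zero (Finset.mem_univ j) (by rw [Matrix.one_apply, if_neg hj])

/-- The parity operator `Π = ⊗_j σ_z^{(j)}`. [cite: MonzEtAl2011, p. 3] -/
noncomputable def parityOp (N : ℕ) : Matrix (Fin N → Bool) (Fin N → Bool) ℂ :=
  tensorWord fun _ : Fin N => Pauli.Z.mat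

/-- `Π` is diagonal with entry `(−1)^{#excitations}`: `Π = Σ_x (−1)^{|x|} |x⟩⟨x|`.
[cite: MonzEtAl2011, p. 3] -/
theorem parityOp_eq_diagonal :
    parityOp N = Matrix.diagonal fun x : Fin N → Bool =>
      (-1 : ℂ) ^ (Finset.univ.filter fun j => x j = true).card := by
  ext y x
  rw [parityOp, tensorWord_apply, Matrix.diagonal_apply]
  by_cases h : y = x
  · subst h
    rw [if_pos rfl]
    have hf : ∀ j, Pauli.Z.mat (y j) (y j) = if y j = true then (-1 : ℂ) else 1 := by
      intro j; cases y j <;> simp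
    simp_rw [hf]
    rw [Finset.prod_ite, Finset.prod_const_one, mul_one, Finset.prod_const]
  · rw [if_neg h]
    have : ∃ j, y j ≠ x j := by
      by_contra hall
      push Not at hall
      exact h (funext hall)
    obtain ⟨j, hj⟩ := this
    exact Finset.prod_eq_zero (Finset.mem_univ j) (by rw [Pauli.mat_Z_apply, if_neg hj])

/-- **`Tr(σ Π) = 𝒫_even − 𝒫_odd`**: the expectation of `Π` in any state `σ` is the probability of
an even number of excitations minus that of an odd number (“`𝒫 = 𝒫_even − 𝒫_odd` with
`𝒫_{even/odd}` corresponding to the probability of finding the state with an even/odd number of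
excitations”). [cite: MonzEtAl2011, p. 3] -/
theorem trState_parityOp (σ : Matrix (Fin N → Bool) (Fin N → Bool) ℂ) :
    trState σ (parityOp N) =
      (∑ x ∈ Finset.univ.filter
          (fun x : Fin N → Bool => Even (Finset.univ.filter fun j => x j = true).card), (σ x x).re) -
      ∑ x ∈ Finset.univ.filter
          (fun x : Fin N → Bool => ¬ Even (Finset.univ.filter fun j => x j = true).card), (σ x x).re := by
  rw [trState_apply, parityOp_eq_diagonal, Matrix.trace]
  simp only [Matrix.diag_apply, Matrix.mul_diagonal]
  rw [Complex.re_sum, ← Finset.sum_filter_add_sum_filter_not Finset.univ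
    (fun x : Fin N → Bool => Even (Finset.univ.filter fun j => x j = true).card), sub_eq_add_neg,
    ← Finset.sum_neg_distrib]
  congr 1
  · refine Finset.sum_congr rfl fun x hx => ?_
    rw [Finset.mem_filter] at hx
    rw [hx.2.neg_one_pow, mul_one]
  · refine Finset.sum_congr rfl fun x hx => ?_
    rw [Finset.mem_filter] at hx
    rw [(Nat.not_even_iff_odd.1 hx.2).neg_one_pow, mul_neg_one, Complex.neg_re]

/-- The collective pulse `U_φ = ⊗_{j=1}^N exp(i π/4 σ_φ^{(j)})`. [cite: MonzEtAl2011, p. 3] -/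
noncomputable def pulseAll (N : ℕ) (φ : ℝ) : Matrix (Fin N → Bool) (Fin N → Bool) ℂ :=
  tensorWord fun _ : Fin N => pulse φ

/-- `U_φ` is unitary: `U_φ† U_φ = 𝟙`. [cite: MonzEtAl2011, p. 3] -/
theorem pulseAll_conjTranspose_mul (φ : ℝ) : (pulseAll N φ)ᴴ * pulseAll N φ = 1 := by
  rw [pulseAll, tensorWord_conjTranspose, ← tensorWord_mul]
  simp only [pulse_conjTranspose_mul_pulse]
  exact tensorWord_one

/-- **The parity signal** of the protocol: rotate by `U_φ`, then measure `Π`: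
`𝒫(φ) = Tr(U_φ ρ U_φ† Π) = Re Tr(ρ U_φ† Π U_φ)`. [cite: MonzEtAl2011, p. 3] -/
noncomputable def paritySignal (ρ : Matrix (Fin N → Bool) (Fin N → Bool) ℂ) (φ : ℝ) : ℝ :=
  trState ρ ((pulseAll N φ)ᴴ * parityOp N * pulseAll N φ)

/-- The signal is the parity `𝒫_even − 𝒫_odd` of the ROTATED state `U_φ ρ U_φ†` (Heisenberg versus
Schrödinger picture, by cyclicity of the trace). [cite: MonzEtAl2011, p. 3] -/
theorem paritySignal_eq_rotated_state (ρ : Matrix (Fin N → Bool) (Fin N → Bool) ℂ) (φ : ℝ) :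
    paritySignal ρ φ = trState (pulseAll N φ * ρ * (pulseAll N φ)ᴴ) (parityOp N) := by
  rw [paritySignal, trState_apply, trState_apply,
    show ρ * ((pulseAll N φ)ᴴ * parityOp N * pulseAll N φ) =
      ρ * (pulseAll N φ)ᴴ * parityOp N * pulseAll N φ by simp only [Matrix.mul_assoc],
    Matrix.trace_mul_cycle, ← Matrix.mul_assoc]

/-- **The rotated parity operator factorises**: `U_φ† Π U_φ = ⊗_j (u_φ† σ_z u_φ)`.
[cite: MonzEtAl2011, p. 3] -/
theorem rotated_parityOp (φ : ℝ) :
    (pulseAll N φ)ᴴ * parityOp N * pulseAll N φ = tensorWord fun _ : Fin N => rotZ φ := by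
  rw [pulseAll, parityOp, tensorWord_conjTranspose, ← tensorWord_mul, ← tensorWord_mul]
  rfl

/-- Entries of `⊗_j (u_φ† σ_z u_φ)`: non-zero only on the ANTI-diagonal `y = x̄`, where the entry is
`(i e^{−iφ})^{|x|} (−i e^{iφ})^{N−|x|}` (`|x|` = number of excitations of `x`).
[cite: MonzEtAl2011, p. 3] -/
theorem tensorWord_rotZ_apply (φ : ℝ) (y x : Fin N → Bool) :
    tensorWord (fun _ : Fin N => rotZ φ) y x =
      if y = (fun j => !x j) then
        (I * exp (-(φ * I))) ^ (Finset.univ.filter fun j => x j = true).card *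
          (-I * exp (φ * I)) ^ (Finset.univ.filter fun j => x j = false).card
      else 0 := by
  rw [tensorWord_apply]
  split_ifs with h
  · subst h
    have hf : ∀ j, rotZ φ (!x j) (x j) =
        if x j = true then I * exp (-(φ * I)) else -I * exp (φ * I) := by
      intro j; rw [rotZ_apply]; cases x j <;> simp
    simp_rw [hf]
    have hfilt : (Finset.univ.filter fun j => ¬ x j = true) =
        Finset.univ.filter fun j => x j = false := by
      ext j
      simp
    rw [Finset.prod_ite, Finset.prod_const, Finset.prod_const, hfilt]
  · have : ∃ j, y j ≠ !x j := by
      by_contra hall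
      push Not at hall
      exact h (funext hall)
    obtain ⟨j, hj⟩ := this
    have hj' : y j = x j := by
      cases hy : y j <;> cases hx : x j <;> simp_all
    exact Finset.prod_eq_zero (Finset.mem_univ j) (by rw [rotZ_apply, if_pos hj'])

/-- **The parity signal of an arbitrary `N`-qubit state**:
`𝒫(φ) = Re Σ_x ρ_{x,x̄} (i e^{−iφ})^{|x|} (−i e^{iφ})^{N−|x|}` — only anti-diagonal entries `ρ_{x,x̄}`
contribute, the entry `ρ_{x,x̄}` at the harmonic `e^{i(N−2|x|)φ}`. [cite: MonzEtAl2011, p. 3] -/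
theorem paritySignal_eq_sum (ρ : Matrix (Fin N → Bool) (Fin N → Bool) ℂ) (φ : ℝ) :
    paritySignal ρ φ = (∑ x : Fin N → Bool, ρ x (fun j => !x j) *
      ((I * exp (-(φ * I))) ^ (Finset.univ.filter fun j => x j = true).card *
        (-I * exp (φ * I)) ^ (Finset.univ.filter fun j => x j = false).card)).re := by
  rw [paritySignal, rotated_parityOp, trState_apply, Matrix.trace]
  simp only [Matrix.diag_apply, Matrix.mul_apply, tensorWord_rotZ_apply, mul_ite, mul_zero,
    Finset.sum_ite_eq', Finset.mem_univ, if_true]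

/-! ## GHZ-like states: a pure order-`N` fringe of amplitude `C` -/

/-- `0…0̄ = 1…1`. [cite: MonzEtAl2011, p. 3] -/
private theorem flip_false : (fun j => !constLabel N false j) = constLabel N true := rfl

/-- `1…1̄ = 0…0`. [cite: MonzEtAl2011, p. 3] -/
private theorem flip_true : (fun j => !constLabel N true j) = constLabel N false := rfl

/-- `|0…0| = 0` excitations. [cite: MonzEtAl2011, p. 3] -/
private theorem card_true_constFalse :
    (Finset.univ.filter fun j => constLabel N false j = true).card = 0 := by simp

/-- `0…0` has `N` zeros. [cite: MonzEtAl2011, p. 3] -/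
private theorem card_false_constFalse :
    (Finset.univ.filter fun j => constLabel N false j = false).card = N := by simp

/-- `|1…1| = N`. [cite: MonzEtAl2011, p. 3] -/
private theorem card_true_constTrue :
    (Finset.univ.filter fun j => constLabel N true j = true).card = N := by simp

/-- `1…1` has no zeros. [cite: MonzEtAl2011, p. 3] -/
private theorem card_false_constTrue :
    (Finset.univ.filter fun j => constLabel N true j = false).card = 0 := by simp

/-- `conj(−i e^{iφ}) = i e^{−iφ}`. [cite: MonzEtAl2011, p. 3] -/
private theorem conj_negI_expI (φ : ℝ) :
    (starRingEnd ℂ) (-I * exp ((φ : ℂ) * I)) = I * exp (-((φ : ℂ) * I)) := by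
  rw [map_mul, map_neg, Complex.conj_I, conj_expI, neg_neg]

/-- **GHZ-like states.**  If the inner anti-diagonal entries vanish (`ρ_{x,x̄} = 0` for
`x ∉ {0…0, 1…1}` — e.g. GHZ states with arbitrary populations and a dephased GHZ coherence) and
`ρ_{1…1,0…0} = conj ρ_{0…0,1…1}`, the signal is a pure fringe of order `N`:
`𝒫(φ) = 2 Re(ρ_{0…0,1…1} (−i e^{iφ})^N)`. [cite: MonzEtAl2011, p. 3] -/
theorem paritySignal_eq_of_antidiag_zero [NeZero N] {ρ : Matrix (Fin N → Bool) (Fin N → Bool) ℂ}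
    (h0 : ∀ x, x ≠ constLabel N false → x ≠ constLabel N true → ρ x (fun j => !x j) = 0)
    (hherm : ρ (constLabel N true) (constLabel N false) =
      (starRingEnd ℂ) (ρ (constLabel N false) (constLabel N true))) (φ : ℝ) :
    paritySignal ρ φ =
      2 * (ρ (constLabel N false) (constLabel N true) * (-I * exp (φ * I)) ^ N).re := by
  rw [paritySignal_eq_sum]
  rw [Finset.sum_eq_add (constLabel N false) (constLabel N true) constLabel_false_ne_true
    (fun x _ hx => by rw [h0 x hx.1 hx.2, zero_mul]) (fun h => absurd (Finset.mem_univ _) h)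
    (fun h => absurd (Finset.mem_univ _) h)]
  rw [flip_false, flip_true, card_true_constFalse, card_false_constFalse, card_true_constTrue,
    card_false_constTrue, pow_zero, one_mul, pow_zero, mul_one, hherm]
  set z := ρ (constLabel N false) (constLabel N true) * (-I * exp ((φ : ℂ) * I)) ^ N
  have hz : (starRingEnd ℂ) (ρ (constLabel N false) (constLabel N true)) *
      (I * exp (-((φ : ℂ) * I))) ^ N = (starRingEnd ℂ) z := by
    rw [map_mul, map_pow, conj_negI_expI]
  rw [hz, Complex.add_conj, Complex.ofReal_re]

/-- `|−i e^{iφ}| = 1`. [cite: MonzEtAl2011, p. 3] -/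
private theorem norm_negI_expI (φ : ℝ) : ‖-I * exp ((φ : ℂ) * I)‖ = 1 := by
  rw [norm_mul, norm_neg, Complex.norm_I, one_mul, Complex.norm_exp_ofReal_mul_I]

/-- **The fringe amplitude is at most `C`**: for a GHZ-like `ρ`, `|𝒫(φ)| ≤ C(ρ)` for every phase
`φ`. [cite: MonzEtAl2011, p. 3 (“The amplitude of these oscillations directly gives the
coherence `C`”)] -/
theorem abs_paritySignal_le_coherence [NeZero N] {ρ : Matrix (Fin N → Bool) (Fin N → Bool) ℂ}
    (h0 : ∀ x, x ≠ constLabel N false → x ≠ constLabel N true → ρ x (fun j => !x j) = 0)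
    (hherm : ρ (constLabel N true) (constLabel N false) =
      (starRingEnd ℂ) (ρ (constLabel N false) (constLabel N true))) (φ : ℝ) :
    |paritySignal ρ φ| ≤ coherence ρ := by
  rw [paritySignal_eq_of_antidiag_zero h0 hherm, coherence, hherm, Complex.norm_conj, abs_mul,
    abs_two]
  have h := Complex.abs_re_le_norm
    (ρ (constLabel N false) (constLabel N true) * (-I * exp ((φ : ℂ) * I)) ^ N)
  rw [norm_mul, norm_pow, norm_negI_expI, one_pow, mul_one] at h
  linarith

/-- **… and it is attained**: some phase `φ` gives `𝒫(φ) = C(ρ)` exactly (`N ≥ 1`), so the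
amplitude of the order-`N` fringe IS the coherence `C = |ρ_{0…0,1…1}| + |ρ_{1…1,0…0}|`.
[cite: MonzEtAl2011, p. 3 (“The amplitude of these oscillations directly gives the coherence
`C`”)] -/
theorem exists_paritySignal_eq_coherence [NeZero N] {ρ : Matrix (Fin N → Bool) (Fin N → Bool) ℂ}
    (h0 : ∀ x, x ≠ constLabel N false → x ≠ constLabel N true → ρ x (fun j => !x j) = 0)
    (hherm : ρ (constLabel N true) (constLabel N false) =
      (starRingEnd ℂ) (ρ (constLabel N false) (constLabel N true))) :
    ∃ φ : ℝ, paritySignal ρ φ = coherence ρ := by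
  set z := ρ (constLabel N false) (constLabel N true) with hzdef
  have hN : (N : ℂ) ≠ 0 := by exact_mod_cast NeZero.ne N
  -- the phase `φ₀ = π/2 − arg(z)/N` aligns the fringe: `(−i e^{iφ₀})^N z = |z|`
  refine ⟨Real.pi / 2 - Complex.arg z / N, ?_⟩
  rw [paritySignal_eq_of_antidiag_zero h0 hherm, coherence, hherm, Complex.norm_conj]
  have hφ : -I * exp ((((Real.pi / 2 - Complex.arg z / N : ℝ)) : ℂ) * I) =
      exp (-(Complex.arg z / N) * I) := by
    have : (((Real.pi / 2 - Complex.arg z / N : ℝ)) : ℂ) * I =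
        (Real.pi / 2 : ℂ) * I + (-(Complex.arg z / N) * I) := by push_cast; ring
    rw [this, Complex.exp_add, Complex.exp_mul_I, Complex.cos_pi_div_two, Complex.sin_pi_div_two]
    ring_nf
    rw [Complex.I_sq]
    ring
  have hpow : (-I * exp ((((Real.pi / 2 - Complex.arg z / N : ℝ)) : ℂ) * I)) ^ N =
      exp (-(Complex.arg z) * I) := by
    rw [hφ, ← Complex.exp_nat_mul]
    congr 1
    field_simp
  have hz : z * exp (-(Complex.arg z) * I) = (‖z‖ : ℂ) := by
    have h := Complex.norm_mul_exp_arg_mul_I z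
    calc z * exp (-(Complex.arg z) * I)
        = (‖z‖ : ℂ) * exp (Complex.arg z * I) * exp (-(Complex.arg z) * I) := by rw [h]
      _ = (‖z‖ : ℂ) := by
          rw [mul_assoc, ← Complex.exp_add,
            show (Complex.arg z : ℂ) * I + -(Complex.arg z : ℂ) * I = 0 by ring, Complex.exp_zero,
            mul_one]
  rw [hpow, hz, Complex.ofReal_re]
  ring

/-! ## General states: the other anti-diagonal entries feed lower harmonics only -/

/-- The harmonic carried by `ρ_{x,x̄}`: `(i e^{−iφ})^k (−i e^{iφ})^m = i^k (−i)^m e^{i(m−k)φ}`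
(`k = |x|`, `m = N − |x|`). [cite: MonzEtAl2011, p. 3] -/
theorem harmonic_factor (φ : ℝ) (k m : ℕ) :
    (I * exp (-(φ * I))) ^ k * (-I * exp (φ * I)) ^ m =
      I ^ k * (-I) ^ m * exp (((m : ℂ) - k) * φ * I) := by
  rw [mul_pow, mul_pow, ← Complex.exp_nat_mul, ← Complex.exp_nat_mul,
    show ((m : ℂ) - k) * φ * I = (k : ℂ) * -(↑φ * I) + (m : ℂ) * (↑φ * I) by ring, Complex.exp_add]
  ring

/-- For an inner label (`x ∉ {0…0, 1…1}`) the excitation number `k = |x|` satisfies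
`1 ≤ k ≤ N − 1`, so its harmonic order `|N − 2k|` is at most `N − 2 < N`: only `ρ_{0…0,1…1}` and
`ρ_{1…1,0…0}` reach the order-`N` fringe from which `C` is read. [cite: MonzEtAl2011, p. 3] -/
theorem inner_excitations_bounds {x : Fin N → Bool} (h0 : x ≠ constLabel N false)
    (h1 : x ≠ constLabel N true) :
    1 ≤ (Finset.univ.filter fun j => x j = true).card ∧
      (Finset.univ.filter fun j => x j = true).card + 1 ≤ N := by
  constructor
  · rw [Nat.one_le_iff_ne_zero, Ne, Finset.card_eq_zero, Finset.filter_eq_empty_iff]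
    intro hall
    apply h0
    funext j
    have := hall (Finset.mem_univ j)
    simpa using this
  · have hlt : (Finset.univ.filter fun j => x j = true).card < (Finset.univ : Finset (Fin N)).card := by
      apply Finset.card_lt_card
      rw [Finset.filter_ssubset]
      by_contra hall
      push Not at hall
      apply h1
      funext j
      simpa using hall j (Finset.mem_univ j)
    rw [Finset.card_univ, Fintype.card_fin] at hlt
    omega

/-! ## General states: the order-`N` Fourier coefficient of the signal is `(−i)^N ρ_{0…0,1…1}` -/

/-- `∫_0^{2π} e^{inφ} dφ = 2π [n = 0]` for an integer `n`. [cite: MonzEtAl2011, p. 3] -/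
private theorem integral_exp_int_mul (n : ℤ) :
    ∫ φ in (0 : ℝ)..2 * Real.pi, exp ((n : ℂ) * φ * I) =
      if n = 0 then ((2 * Real.pi : ℝ) : ℂ) else 0 := by
  split_ifs with hn
  · subst hn
    simp
  · have hc : (n : ℂ) * I ≠ 0 := mul_ne_zero (by exact_mod_cast hn) Complex.I_ne_zero
    have hfun : (fun φ : ℝ => exp ((n : ℂ) * φ * I)) = fun φ : ℝ => exp ((n : ℂ) * I * φ) := by
      funext φ; ring_nf
    rw [hfun, integral_exp_mul_complex hc]
    have h1 : exp ((n : ℂ) * I * ((2 * Real.pi : ℝ) : ℂ)) = 1 := by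
      rw [show (n : ℂ) * I * ((2 * Real.pi : ℝ) : ℂ) = n * (2 * Real.pi * I) by push_cast; ring]
      exact Complex.exp_int_mul_two_pi_mul_I n
    rw [h1]
    simp

/-- One anti-diagonal term times `e^{−iNφ}`, split into its two rotating components.
[cite: MonzEtAl2011, p. 3] -/
private theorem term_mul_exp (a : ℂ) (f : ℤ) (M : ℕ) (φ : ℝ) :
    (a * exp ((f : ℂ) * φ * I) + (starRingEnd ℂ) (a * exp ((f : ℂ) * φ * I))) / 2 *
        exp (-((M : ℂ) * φ * I)) =
      a / 2 * exp (((f - M : ℤ) : ℂ) * φ * I) +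
        (starRingEnd ℂ) a / 2 * exp (((-f - M : ℤ) : ℂ) * φ * I) := by
  have e1 : exp (((f - M : ℤ) : ℂ) * φ * I) = exp ((f : ℂ) * φ * I) * exp (-((M : ℂ) * φ * I)) := by
    rw [← Complex.exp_add]; congr 1; push_cast; ring
  have e2 : exp (((-f - M : ℤ) : ℂ) * φ * I) =
      exp ((f : ℂ) * φ * -I) * exp (-((M : ℂ) * φ * I)) := by
    rw [← Complex.exp_add]; congr 1; push_cast; ring
  rw [e1, e2, map_mul, ← Complex.exp_conj, map_mul, map_mul, Complex.conj_ofReal, Complex.conj_I,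
    map_intCast]
  ring

/-- Each rotating component is continuous in the phase. [cite: MonzEtAl2011, p. 3] -/
private theorem continuous_rot (a c : ℂ) : Continuous fun φ : ℝ => a * exp (c * φ * I) := by
  fun_prop

/-- **The order-`N` Fourier coefficient of the parity signal of an ARBITRARY state**:
`∫_0^{2π} 𝒫(φ) e^{−iNφ} dφ = π (−i)^N (ρ_{0…0,1…1} + conj ρ_{1…1,0…0})` (`N ≥ 1`).  All other
anti-diagonal entries `ρ_{x,x̄}` oscillate at orders `|N − 2|x|| ≤ N − 2` and drop out; for a
Hermitian `ρ` the right-hand side is `2π (−i)^N ρ_{0…0,1…1}`, of modulus `π·C(ρ)` — the precise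
sense in which the order-`N` fringe amplitude “directly gives the coherence `C`” for any state.
[cite: MonzEtAl2011, p. 3] -/
theorem integral_paritySignal_mul_exp [NeZero N] (ρ : Matrix (Fin N → Bool) (Fin N → Bool) ℂ) :
    ∫ φ in (0 : ℝ)..2 * Real.pi, (paritySignal ρ φ : ℂ) * exp (-((N : ℂ) * φ * I)) =
      Real.pi * (-I) ^ N * (ρ (constLabel N false) (constLabel N true) +
        (starRingEnd ℂ) (ρ (constLabel N true) (constLabel N false))) := by
  classical
  -- bookkeeping: `k x` ones, `m x` zeros, `k + m = N`
  set k : (Fin N → Bool) → ℕ := fun x => (Finset.univ.filter fun j => x j = true).card with hk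
  set m : (Fin N → Bool) → ℕ := fun x => (Finset.univ.filter fun j => x j = false).card with hm
  have hkm : ∀ x, k x + m x = N := by
    intro x
    have h := Finset.card_filter_add_card_filter_not (s := Finset.univ)
      (fun j : Fin N => x j = true)
    have hfilt : (Finset.univ.filter fun j => ¬ x j = true) =
        Finset.univ.filter fun j => x j = false := by
      ext j; simp
    rw [hfilt, Finset.card_univ, Fintype.card_fin] at h
    exact h
  -- amplitude and frequency of the term of `x`
  set a : (Fin N → Bool) → ℂ := fun x => ρ x (fun j => !x j) * (I ^ k x * (-I) ^ m x) with ha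
  set f : (Fin N → Bool) → ℤ := fun x => (m x : ℤ) - k x with hf
  have hterm : ∀ (x : Fin N → Bool) (φ : ℝ), ρ x (fun j => !x j) *
      ((I * exp (-((φ : ℂ) * I))) ^ (Finset.univ.filter fun j => x j = true).card *
        (-I * exp ((φ : ℂ) * I)) ^ (Finset.univ.filter fun j => x j = false).card) =
      a x * exp ((f x : ℂ) * φ * I) := by
    intro x φ
    rw [harmonic_factor]
    simp only [ha, hf]
    push_cast
    ring
  -- the integrand, split into rotating components
  have hint : ∀ φ : ℝ, (paritySignal ρ φ : ℂ) * exp (-((N : ℂ) * φ * I)) =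
      ∑ x : Fin N → Bool, (a x / 2 * exp (((f x - N : ℤ) : ℂ) * φ * I) +
        (starRingEnd ℂ) (a x) / 2 * exp (((-f x - N : ℤ) : ℂ) * φ * I)) := by
    intro φ
    rw [paritySignal_eq_sum, Complex.re_eq_add_conj, map_sum, ← Finset.sum_add_distrib,
      Finset.sum_div, Finset.sum_mul]
    refine Finset.sum_congr rfl fun x _ => ?_
    rw [hterm, term_mul_exp]
  simp_rw [hint]
  have hI : ∀ x ∈ (Finset.univ : Finset (Fin N → Bool)), IntervalIntegrable
      (fun φ : ℝ => a x / 2 * exp (((f x - N : ℤ) : ℂ) * φ * I) +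
        (starRingEnd ℂ) (a x) / 2 * exp (((-f x - N : ℤ) : ℂ) * φ * I))
      MeasureTheory.volume 0 (2 * Real.pi) := by
    intro x _
    apply Continuous.intervalIntegrable
    fun_prop
  rw [intervalIntegral.integral_finsetSum hI]
  have hx : ∀ x : Fin N → Bool,
      ∫ φ in (0 : ℝ)..2 * Real.pi, (a x / 2 * exp (((f x - N : ℤ) : ℂ) * φ * I) +
        (starRingEnd ℂ) (a x) / 2 * exp (((-f x - N : ℤ) : ℂ) * φ * I)) =
      a x / 2 * (if f x - N = 0 then ((2 * Real.pi : ℝ) : ℂ) else 0) +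
        (starRingEnd ℂ) (a x) / 2 * (if -f x - N = 0 then ((2 * Real.pi : ℝ) : ℂ) else 0) := by
    intro x
    rw [intervalIntegral.integral_add ((continuous_rot _ _).intervalIntegrable _ _)
      ((continuous_rot _ _).intervalIntegrable _ _), intervalIntegral.integral_const_mul,
      intervalIntegral.integral_const_mul, integral_exp_int_mul, integral_exp_int_mul]
  simp_rw [hx]
  -- only `x = 0…0` (first component) and `x = 1…1` (second component) survive
  have hk0 : k (constLabel N false) = 0 := by simp [hk]
  have hm0 : m (constLabel N false) = N := by simp [hm]
  have hk1 : k (constLabel N true) = N := by simp [hk]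
  have hm1 : m (constLabel N true) = 0 := by simp [hm]
  have hN : (N : ℤ) ≠ 0 := by exact_mod_cast NeZero.ne N
  rw [Finset.sum_eq_add (constLabel N false) (constLabel N true) constLabel_false_ne_true
    ?_ (fun h => absurd (Finset.mem_univ _) h) (fun h => absurd (Finset.mem_univ _) h)]
  · have hf0 : f (constLabel N false) = N := by simp only [hf, hk0, hm0]; ring
    have hf1 : f (constLabel N true) = -N := by simp only [hf, hk1, hm1]; push_cast; ring
    have c1 : f (constLabel N false) - N = 0 := by rw [hf0]; ring
    have c2 : ¬ (-f (constLabel N false) - N = 0) := by rw [hf0]; omega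
    have c3 : ¬ (f (constLabel N true) - N = 0) := by rw [hf1]; omega
    have c4 : -f (constLabel N true) - N = 0 := by rw [hf1]; ring
    rw [if_pos c1, if_neg c2, if_neg c3, if_pos c4]
    have ha0 : a (constLabel N false) = ρ (constLabel N false) (constLabel N true) * (-I) ^ N := by
      simp only [ha, hk0, hm0, pow_zero, one_mul]; rfl
    have ha1 : a (constLabel N true) = ρ (constLabel N true) (constLabel N false) * I ^ N := by
      simp only [ha, hk1, hm1, pow_zero, mul_one]; rfl
    rw [ha0, ha1]
    simp only [map_mul, map_pow, map_neg, Complex.conj_I, neg_neg]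
    push_cast
    ring
  · intro x _ hx01
    obtain ⟨h1, h2⟩ := inner_excitations_bounds hx01.1 hx01.2
    have h1' : 1 ≤ k x := h1
    have h2' : k x + 1 ≤ N := h2
    have hkx := hkm x
    have c1 : ¬ (f x - N = 0) := by simp only [hf]; omega
    have c2 : ¬ (-f x - N = 0) := by simp only [hf]; omega
    rw [if_neg c1, if_neg c2, mul_zero, mul_zero, add_zero]

end ParityOscillation

end Literature.InformationTheory.Entanglement
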